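import Summits.ValiantsHypothesis.ValiantsHypothesis.Theorems.BarrierLeverPartitionMinorsBlockVandermondePrelims

/-!
# Route BarrierLever — item `PartitionMinorsHitByVP` (stmt-ValiantsHypothesis-19717):
# the block generalized-Vandermonde theorem, RESIDUE form (characteristic `p`)

Helper file (`--supports stmt-ValiantsHypothesis-19717`; cell valiant-natproofs, rung V4, 𝒟-side door (c),
prover seat val-np-p1, gen 11). Closes NO item; definition-free; pure algebra over `K[X]`, `char K = p`.

`…BlockVandermonde.det_pow_ne_zero_of_blocks` asks that each valuation class of size `g` carry `g`
CONSECUTIVE exponents. In characteristic `p` this relaxes to a RESIDUE condition: for a class of size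
`g ≤ p^s` it suffices that the exponents occupy `g` CYCLICALLY CONSECUTIVE residues modulo `p^s`
(`(D_j − A) mod p^s ∈ [0, g)`, pairwise distinct, for some shift `A`); for `g = p^s` this just says
«exponents pairwise distinct mod `p^s`». Reason: the only place where consecutiveness entered was the
Taylor block `[C(D_j, a)]_{a<g}` modulo `X`; in characteristic `p`, `(1+X)^{p^s} = 1 + X^{p^s}` makes the
coefficients `C(D, a)`, `a < p^s`, depend on `D mod p^s` only (`choose_cast_eq_of_mod_eq`), so the block is the
unimodular Pascal block `[C(A + κ_j, a)]` again. Everything else in the induction (`det_ne_zero_res_aux`) is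
verbatim `…BlockVandermonde.det_ne_zero_aux` (rescale, node-polynomial division, adjugate elimination,
same-shape Schur complement); user-facing form `det_pow_ne_zero_of_residues`. Cross-class hypothesis unchanged:
exponents DEcrease from each valuation class to every higher one.

Used by `…PartitionMinorsHitByVPBlockResidue` (19717 certificates with `p`-adic windows).
WHAT THIS IS NOT: nothing on circuits here; item 19717 stays open; nothing on CPM, crux 14610 or VP vs VNP.
-/

set_option linter.dupNamespace false

namespace Summit.ValiantsHypothesis.ValiantsHypothesis.Theorems.BarrierLever.BlockVandermonde

open Finset Polynomial Matrix

noncomputable section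

universe u

/-! ## 1. Binomial coefficients modulo `p` see only `D mod p^s` -/

/-- In characteristic `p`, `C(D, a) = C(D', a)` in `K` for `a < p^s` whenever `D ≡ D' (mod p^s)`:
compare the coefficients of `X^a` in `(1+X)^D = (1+X)^{D mod p^s} · (1 + X^{p^s})^{D / p^s}`. -/
theorem choose_cast_eq_of_mod_eq (K : Type*) [Field K] (p : ℕ) [Fact p.Prime] [CharP K p] (s : ℕ)
    {a D D' : ℕ} (ha : a < p ^ s) (hDD' : D % p ^ s = D' % p ^ s) :
    (((D.choose a : ℕ) : K)) = ((D'.choose a : ℕ) : K) := by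
  suffices key : ∀ E : ℕ, ((E.choose a : ℕ) : K) = (((E % p ^ s).choose a : ℕ) : K) by
    rw [key D, key D', hDD']
  intro E
  have hfrob : ((1 + X : K[X]) ^ p ^ s) = 1 + X ^ p ^ s := by
    rw [add_pow_char_pow, one_pow]
  have hE : ((1 + X : K[X]) ^ E) = (1 + X) ^ (E % p ^ s) * (1 + X ^ p ^ s) ^ (E / p ^ s) := by
    conv_lhs => rw [← Nat.mod_add_div E (p ^ s), pow_add, pow_mul, hfrob]
  have hcoeff : ((1 + X : K[X]) ^ E).coeff a = ((1 + X : K[X]) ^ (E % p ^ s)).coeff a := by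
    rw [hE, coeff_mul]
    rw [Finset.sum_eq_single (a, 0)]
    · rw [coeff_zero_eq_eval_zero]
      simp only [eval_pow, eval_add, eval_one, eval_X, zero_pow (pow_pos (Fact.out : p.Prime).pos s).ne',
        add_zero, one_pow, mul_one]
    · rintro ⟨b₁, b₂⟩ hb hne
      have hb' : b₁ + b₂ = a := by simpa using Finset.HasAntidiagonal.mem_antidiagonal.mp hb
      have hb₂ : b₂ ≠ 0 := fun h0 => hne (by
        subst h0
        simp only [add_zero] at hb'
        rw [hb'])
      -- the coefficient of `X^{b₂}` in `(1 + X^{p^s})^q` vanishes for `0 < b₂ < p^s`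
      have hlt : b₂ < p ^ s := by omega
      suffices h0 : ((1 + X ^ p ^ s : K[X]) ^ (E / p ^ s)).coeff b₂ = 0 by rw [h0, mul_zero]
      rw [add_comm, add_pow]
      rw [finsetSum_coeff]
      refine Finset.sum_eq_zero fun k _ => ?_
      rw [one_pow, mul_one, ← pow_mul, ← Nat.cast_comm, ← C_eq_natCast, coeff_C_mul, coeff_X_pow]
      rw [if_neg, mul_zero]
      intro hk
      exact absurd (Nat.le_of_dvd (Nat.pos_of_ne_zero hb₂) ⟨k, hk⟩) (not_le.mpr hlt)
    · intro h
      exact (h (Finset.HasAntidiagonal.mem_antidiagonal.mpr (by simp))).elim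
  have h1 := coeff_one_add_X_pow K E a
  have h2 := coeff_one_add_X_pow K (E % p ^ s) a
  rw [← h1, ← h2, hcoeff]

/-! ## 2. The residue form of the block Vandermonde theorem -/

/-- **BLOCK VANDERMONDE, residue form (inductive statement).** As `det_ne_zero_aux`, in characteristic `p`,
with the in-class run condition replaced by: class sizes `g ≤ p^{s}` and shifted residues
`(D_j + p^s − A mod p^s) mod p^s ∈ [0, g)` pairwise distinct inside each class (data `s, A` may be given per
row; only the values at the class representative are used). -/
theorem det_ne_zero_res_aux (K : Type*) [Field K] (p : ℕ) [Fact p.Prime] [CharP K p] (n : ℕ) :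
    ∀ {ι : Type u} [Fintype ι] [DecidableEq ι], Fintype.card ι = n →
    ∀ (m : ι → ℕ) (ρ : ι → K[X]) (D : ι → ℕ) (T N : ℕ) (c : ι → Fin N → K[X])
      (hDN : ∀ j, D j < N) (s A : ι → ℕ),
      (∀ i, 1 ≤ m i) →
      (∀ i i', m i = m i' → ρ i = ρ i' → i = i') →
      Function.Injective D →
      (∀ j, D j < T) →
      (∀ j, (c j ⟨D j, hDN j⟩).coeff 0 ≠ 0) →
      (∀ j (e : Fin N), (e : ℕ) < T → (e : ℕ) ≠ D j → c j e = 0) →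
      (∀ i i', m i < m i' → D i' < D i) →
      (∀ i, Fintype.card {k // m k = m i} ≤ p ^ s i) →
      (∀ i i', m i' = m i →
        (D i' + (p ^ s i - A i % p ^ s i)) % p ^ s i < Fintype.card {k // m k = m i}) →
      (∀ i i' i'', m i' = m i → m i'' = m i →
        (D i' + (p ^ s i - A i % p ^ s i)) % p ^ s i = (D i'' + (p ^ s i - A i % p ^ s i)) % p ^ s i →
          i' = i'') →
      (Matrix.of fun i j : ι => ∑ e : Fin N, (X ^ (m i) * (1 + X * ρ i)) ^ (e : ℕ) * c j e).det ≠ 0 := by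
  induction n using Nat.strong_induction_on with
  | _ n ih =>
  intro ι _ _ hn m ρ D T N c hDN s A hm hρ hD hDT hc0 hcT hlt hg hwin hinj
  rcases isEmpty_or_nonempty ι with hι | hι
  · rw [Matrix.det_isEmpty]
    exact one_ne_zero
  obtain ⟨i₀, -, hi₀⟩ := Finset.exists_min_image Finset.univ m Finset.univ_nonempty
  have hμ : ∀ i, m i₀ ≤ m i := fun i => hi₀ i (Finset.mem_univ i)
  have hμ1 : 1 ≤ m i₀ := hm i₀
  set ξ' : ι → K[X] := fun i => X ^ (m i - m i₀) * (1 + X * ρ i) with hξ'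
  set c' : ι → Fin N → K[X] := fun j e => X ^ (m i₀ * ((e : ℕ) - D j)) * c j e with hc'
  set M' : Matrix ι ι K[X] := Matrix.of fun i j => ∑ e : Fin N, ξ' i ^ (e : ℕ) * c' j e with hM'
  have hresc : (Matrix.of fun i j : ι => ∑ e : Fin N, (X ^ (m i) * (1 + X * ρ i)) ^ (e : ℕ) * c j e)
      = M' * Matrix.diagonal (fun j => X ^ (m i₀ * D j)) := by
    refine Matrix.ext fun i j => ?_
    simp only [Matrix.mul_diagonal, hM', Matrix.of_apply, Finset.sum_mul]
    refine Finset.sum_congr rfl fun e _ => ?_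
    by_cases he : D j ≤ (e : ℕ)
    · have h1 : X ^ (m i) * (1 + X * ρ i) = X ^ (m i₀) * ξ' i := by
        rw [hξ', ← mul_assoc, ← pow_add, Nat.add_sub_cancel' (hμ i)]
      have h2 : m i₀ * (e : ℕ) = m i₀ * ((e : ℕ) - D j) + m i₀ * D j := by
        rw [← Nat.mul_add, Nat.sub_add_cancel he]
      rw [h1, mul_pow, ← pow_mul, h2, pow_add, hc']
      ring
    · have hce : c j e = 0 := hcT j e (by have := hDT j; omega) (by omega)
      rw [hc']
      simp only [hce, mul_zero, zero_mul]
  rw [hresc, Matrix.det_mul, Matrix.det_diagonal]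
  refine mul_ne_zero ?_ (Finset.prod_ne_zero_iff.mpr fun j _ => pow_ne_zero _ X_ne_zero)
  have hc'D : ∀ j, c' j ⟨D j, hDN j⟩ = c j ⟨D j, hDN j⟩ := fun j => by
    rw [hc']
    simp only [Nat.sub_self, mul_zero, pow_zero, one_mul]
  have hc'T : ∀ j (e : Fin N), (e : ℕ) < T → (e : ℕ) ≠ D j → c' j e = 0 := fun j e h1 h2 => by
    rw [hc']
    simp only [hcT j e h1 h2, mul_zero]
  have hc'0 : ∀ j (e : Fin N), (e : ℕ) ≠ D j → (c' j e).coeff 0 = 0 := fun j e h2 => by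
    by_cases h1 : (e : ℕ) < T
    · rw [hc'T j e h1 h2, coeff_zero]
    · have hpos : m i₀ * ((e : ℕ) - D j) ≠ 0 := by
        have := hDT j
        exact Nat.mul_ne_zero (by omega) (by omega)
      rw [hc']
      simp only [coeff_X_pow_mul', if_neg (Nat.not_le.mpr (Nat.pos_of_ne_zero hpos))]
  set ι₁ := {i // m i = m i₀} with hι₁
  set ι₂ := {i // ¬ m i = m i₀} with hι₂
  haveI : Nonempty ι₁ := ⟨⟨i₀, rfl⟩⟩
  have hcard : Fintype.card ι₁ + Fintype.card ι₂ = n := by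
    show Fintype.card {i // m i = m i₀} + Fintype.card {i // ¬ m i = m i₀} = n
    rw [Fintype.card_subtype_compl, Nat.add_sub_cancel' (Fintype.card_subtype_le _), hn]
  have hcard₁ : 0 < Fintype.card ι₁ := Fintype.card_pos
  have hμ2 : ∀ i : ι₂, m i₀ < m i.1 := fun i => lt_of_le_of_ne (hμ i.1) (Ne.symm i.2)
  /- the residue structure of the exponents of the least class -/
  set P : ℕ := p ^ s i₀ with hP
  set a₀ : ℕ := A i₀ % P with ha₀
  have hPpos : 0 < P := by rw [hP]; exact pow_pos (Fact.out : p.Prime).pos _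
  have ha₀P : a₀ ≤ P := (Nat.mod_lt _ hPpos).le
  have hgP : Fintype.card ι₁ ≤ P := hg i₀
  let κf : ι₁ → Fin (Fintype.card ι₁) := fun j => ⟨(D j.1 + (P - a₀)) % P, hwin i₀ j.1 j.2⟩
  have hκf : Function.Bijective κf :=
    (Fintype.bijective_iff_injective_and_card κf).mpr
      ⟨fun j j' h => Subtype.ext (hinj i₀ j.1 j'.1 j.2 j'.2 (congrArg Fin.val h)), by simp⟩
  set κ : ι₁ ≃ Fin (Fintype.card ι₁) := Equiv.ofBijective κf hκf with hκdef
  have hκ : ∀ j : ι₁, (κ j : ℕ) = (D j.1 + (P - a₀)) % P := fun j => rfl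
  have hκmod : ∀ j : ι₁, (a₀ + (κ j : ℕ)) % P = D j.1 % P := fun j => by
    rw [hκ j, Nat.add_mod_mod, show a₀ + (D j.1 + (P - a₀)) = D j.1 + P by omega, Nat.add_mod_right]
  obtain ⟨k₀, -, hk₀⟩ := Finset.exists_min_image Finset.univ (fun j : ι₁ => D j.1) Finset.univ_nonempty
  have hA1 : ∀ j : ι₁, D k₀.1 ≤ D j.1 := fun j => hk₀ j (Finset.mem_univ j)
  have hAT : D k₀.1 < T := hDT k₀.1
  have hA2 : ∀ j : ι₂, D j.1 < D k₀.1 := fun j => hlt k₀.1 j.1 (by rw [k₀.2]; exact hμ2 j)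
  set x : ι₁ → K[X] := fun i => X * ρ i.1 with hx
  set G : ι → K[X][X] := fun j => ∑ e : Fin N, C (c' j e) * (1 + X) ^ (e : ℕ) with hG
  have hGeval : ∀ (i : ι₁) (j : ι), (G j).eval (x i) = M' i.1 j := by
    intro i j
    rw [hG, hM', Matrix.of_apply]
    simp only [eval_finsetSum, eval_mul, eval_C, eval_pow, eval_add, eval_one, eval_X]
    refine Finset.sum_congr rfl fun e _ => ?_
    rw [hξ', hx]
    simp only [i.2, Nat.sub_self, pow_zero, one_mul, mul_comm]
  set Ntop : Matrix ι₁ ι K[X] := Matrix.of fun k j =>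
    (G j %ₘ ∏ i' : ι₁, (X - C (x i'))).coeff (κ k : ℕ) with hNtop
  set V : Matrix ι₁ ι₁ K[X] := Matrix.of fun i k => ρ i.1 ^ (κ k : ℕ) with hV
  set Dg : ι₁ → K[X] := fun k => X ^ (κ k : ℕ) with hDg
  have hkey : ∀ (i : ι₁) (j : ι), M' i.1 j = (V * (Matrix.diagonal Dg * Ntop)) i j := by
    intro i j
    rw [← hGeval i j, eval_node_eq_sum x (G j) i, ← Fin.sum_univ_eq_sum_range, Matrix.mul_apply,
      ← Equiv.sum_comp κ]
    refine Finset.sum_congr rfl fun k _ => ?_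
    rw [Matrix.diagonal_mul, hV, hNtop, hDg, hx, Matrix.of_apply, Matrix.of_apply, mul_pow]
    ring
  set σ : ι₁ ⊕ ι₂ ≃ ι := Equiv.sumCompl fun i => m i = m i₀ with hσ
  set N11 : Matrix ι₁ ι₁ K[X] := Matrix.of fun k j => Ntop k j.1 with hN11
  set N12 : Matrix ι₁ ι₂ K[X] := Matrix.of fun k j => Ntop k j.1 with hN12
  set M21 : Matrix ι₂ ι₁ K[X] := Matrix.of fun i j => M' i.1 j.1 with hM21
  set M22 : Matrix ι₂ ι₂ K[X] := Matrix.of fun i j => M' i.1 j.1 with hM22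
  have hblock : M'.submatrix σ σ =
      Matrix.fromBlocks (V * Matrix.diagonal Dg) 0 0 (1 : Matrix ι₂ ι₂ K[X]) *
        Matrix.fromBlocks N11 N12 M21 M22 := by
    rw [Matrix.fromBlocks_multiply]
    refine Matrix.ext ?_
    rintro (i | i) (j | j)
    · rw [Matrix.submatrix_apply, hσ, Equiv.sumCompl_apply_inl, Equiv.sumCompl_apply_inl,
        Matrix.fromBlocks_apply₁₁, Matrix.zero_mul, add_zero, Matrix.mul_assoc, hkey i j.1]
      simp only [Matrix.mul_apply, hN11, Matrix.of_apply]
    · rw [Matrix.submatrix_apply, hσ, Equiv.sumCompl_apply_inl, Equiv.sumCompl_apply_inr,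
        Matrix.fromBlocks_apply₁₂, Matrix.zero_mul, add_zero, Matrix.mul_assoc, hkey i j.1]
      simp only [Matrix.mul_apply, hN12, Matrix.of_apply]
    · rw [Matrix.submatrix_apply, hσ, Equiv.sumCompl_apply_inr, Equiv.sumCompl_apply_inl,
        Matrix.fromBlocks_apply₂₁, Matrix.zero_mul, zero_add, Matrix.one_mul, hM21, Matrix.of_apply]
    · rw [Matrix.submatrix_apply, hσ, Equiv.sumCompl_apply_inr, Equiv.sumCompl_apply_inr,
        Matrix.fromBlocks_apply₂₂, Matrix.zero_mul, zero_add, Matrix.one_mul, hM22, Matrix.of_apply]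
  have hVdet : V.det ≠ 0 := by
    set v : Fin (Fintype.card ι₁) → K[X] := fun a => ρ (κ.symm a).1 with hv
    have hVv : V = (Matrix.vandermonde v).submatrix κ κ := by
      refine Matrix.ext fun i k => ?_
      simp only [Matrix.submatrix_apply, Matrix.vandermonde_apply, hV, hv, Matrix.of_apply,
        Equiv.symm_apply_apply]
    rw [hVv, Matrix.det_submatrix_equiv_self, Matrix.det_vandermonde_ne_zero_iff]
    intro a b hab
    have h1 : (κ.symm a).1 = (κ.symm b).1 :=
      hρ _ _ (by rw [(κ.symm a).2, (κ.symm b).2]) hab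
    exact κ.symm.injective (Subtype.ext h1)
  have hDgdet : (Matrix.diagonal Dg).det ≠ 0 := by
    rw [Matrix.det_diagonal]
    exact Finset.prod_ne_zero_iff.mpr fun k _ => pow_ne_zero _ X_ne_zero
  rw [← Matrix.det_submatrix_equiv_self σ M', hblock, Matrix.det_mul, Matrix.det_fromBlocks_zero₂₁,
    Matrix.det_one, mul_one, Matrix.det_mul]
  refine mul_ne_zero (mul_ne_zero hVdet hDgdet) ?_
  set φ₀ : K[X] →+* K := Polynomial.evalRingHom 0 with hφ₀
  have hφx : ∀ i : ι₁, φ₀ (x i) = 0 := fun i => by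
    rw [hφ₀, hx]
    simp
  have hGmap : ∀ j : ι, (G j).map φ₀ = C ((c j ⟨D j, hDN j⟩).coeff 0) * (1 + X) ^ (D j) := by
    intro j
    rw [hG, Polynomial.map_sum, Finset.sum_eq_single (⟨D j, hDN j⟩ : Fin N)]
    · rw [Polynomial.map_mul, map_C, Polynomial.map_pow, Polynomial.map_add, Polynomial.map_one,
        map_X, hc'D, hφ₀, coe_evalRingHom, ← coeff_zero_eq_eval_zero]
    · intro e _ he
      have he' : (e : ℕ) ≠ D j := fun h => he (Fin.ext h)
      rw [Polynomial.map_mul, map_C, hφ₀, coe_evalRingHom, ← coeff_zero_eq_eval_zero, hc'0 j e he',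
        C_0, zero_mul]
    · intro h
      exact absurd (Finset.mem_univ _) h
  have hN11map : N11.map φ₀ =
      (Matrix.of fun a b : Fin (Fintype.card ι₁) =>
          (((a₀ + (b : ℕ)).choose (a : ℕ) : ℕ) : K)).submatrix κ κ *
        Matrix.diagonal fun j : ι₁ => (c j.1 ⟨D j.1, hDN j.1⟩).coeff 0 := by
    refine Matrix.ext fun k j => ?_
    rw [Matrix.mul_diagonal, Matrix.map_apply, hN11, Matrix.of_apply, hNtop, Matrix.of_apply,
      map_coeff_modByMonic_nodes φ₀ x hφx (G j.1) (κ k).isLt, hGmap, coeff_C_mul,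
      coeff_one_add_X_pow, Matrix.submatrix_apply, Matrix.of_apply, mul_comm,
      choose_cast_eq_of_mod_eq K p (s i₀) (lt_of_lt_of_le (κ k).isLt hgP) ((hκmod j).symm)]
  have hd0 : φ₀ N11.det ≠ 0 := by
    rw [RingHom.map_det, RingHom.mapMatrix_apply, hN11map, Matrix.det_mul,
      Matrix.det_submatrix_equiv_self, pascal_det_eq_one, one_mul, Matrix.det_diagonal]
    exact Finset.prod_ne_zero_iff.mpr fun j _ => hc0 j.1
  have hd : N11.det ≠ 0 := fun h => hd0 (by rw [h, map_zero])
  have hd0' : (N11.det).coeff 0 ≠ 0 := by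
    rwa [hφ₀, coe_evalRingHom, ← coeff_zero_eq_eval_zero] at hd0
  refine det_fromBlocks_ne_zero_of_schur N11 N12 M21 M22 hd ?_
  set Ξ : Matrix ι₂ (Fin N) K[X] := Matrix.of fun i e => ξ' i.1 ^ (e : ℕ) with hΞ
  set Cm₁ : Matrix (Fin N) ι₁ K[X] := Matrix.of fun e j => c' j.1 e with hCm₁
  set Cm₂ : Matrix (Fin N) ι₂ K[X] := Matrix.of fun e j => c' j.1 e with hCm₂
  set c₂ : ι₂ → Fin N → K[X] := fun j e => (N11.det • Cm₂ - Cm₁ * N11.adjugate * N12) e j with hc₂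
  have hM21 : M21 = Ξ * Cm₁ := by
    refine Matrix.ext fun i j => ?_
    rw [hM21, Matrix.of_apply, hM', Matrix.of_apply, Matrix.mul_apply]
    rfl
  have hM22 : M22 = Ξ * Cm₂ := by
    refine Matrix.ext fun i j => ?_
    rw [hM22, Matrix.of_apply, hM', Matrix.of_apply, Matrix.mul_apply]
    rfl
  have hS : N11.det • M22 - M21 * N11.adjugate * N12 =
      Matrix.of fun i j : ι₂ => ∑ e : Fin N,
        (X ^ (m i.1 - m i₀) * (1 + X * ρ i.1)) ^ (e : ℕ) * c₂ j e := by
    have h1 : N11.det • M22 - M21 * N11.adjugate * N12 =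
        Ξ * (N11.det • Cm₂ - Cm₁ * N11.adjugate * N12) := by
      rw [hM21, hM22, Matrix.mul_sub, Matrix.mul_smul, Matrix.mul_assoc, Matrix.mul_assoc,
        Matrix.mul_assoc]
    rw [h1]
    refine Matrix.ext fun i j => ?_
    rw [Matrix.mul_apply, Matrix.of_apply]
    rfl
  rw [hS]
  have hlt₂ : Fintype.card ι₂ < n := by omega
  have hcc : ∀ i : ι₂, Fintype.card {k : ι₂ // m k.1 - m i₀ = m i.1 - m i₀} =
      Fintype.card {k // m k = m i.1} := fun i => by
    have h3 := hμ2 i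
    rw [Fintype.card_congr (Equiv.subtypeSubtypeEquivSubtype (p := fun k => ¬ m k = m i₀)
      (q := fun k => m k - m i₀ = m i.1 - m i₀) (fun k hk => by omega))]
    exact Fintype.card_congr (Equiv.subtypeEquivRight fun k => by constructor <;> intro hk <;> omega)
  refine ih (Fintype.card ι₂) hlt₂ rfl (fun i : ι₂ => m i.1 - m i₀) (fun i => ρ i.1) (fun j => D j.1)
    (D k₀.1) N c₂ (fun j => hDN j.1) (fun i => s i.1) (fun i => A i.1) ?_ ?_ ?_ ?_ ?_ ?_ ?_ ?_ ?_ ?_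
  · -- valuations stay ≥ 1
    intro i
    have := hμ2 i
    omega
  · -- distinct within a class
    intro i i' h1 h2
    have := hμ2 i
    have := hμ2 i'
    exact Subtype.ext (hρ i.1 i'.1 (by omega) h2)
  · -- exponents injective
    exact fun j j' h => Subtype.ext (hD h)
  · -- exponents below the new threshold `A`
    exact hA2
  · -- leading coefficient: constant term nonzero
    intro j
    have hvan : ∀ j' : ι₁, Cm₁ ⟨D j.1, hDN j.1⟩ j' = 0 := fun j' => by
      rw [hCm₁, Matrix.of_apply]
      refine hc'T j'.1 _ (hDT j.1) fun h => ?_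
      have hjj : j.1 = j'.1 := hD (by simpa using h)
      exact j.2 (by rw [hjj]; exact j'.2)
    have hrow : (Cm₁ * N11.adjugate * N12) ⟨D j.1, hDN j.1⟩ j = 0 := by
      rw [Matrix.mul_assoc, Matrix.mul_apply]
      exact Finset.sum_eq_zero fun j' _ => by rw [hvan j', zero_mul]
    rw [hc₂]
    simp only [Matrix.sub_apply, Matrix.smul_apply, smul_eq_mul, hrow, sub_zero, hCm₂, Matrix.of_apply,
      hc'D, mul_coeff_zero]
    exact mul_ne_zero hd0' (hc0 j.1)
  · -- no other term below `A`
    intro j e h1 h2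
    have hv2 : Cm₂ e j = 0 := by
      rw [hCm₂, Matrix.of_apply]
      exact hc'T j.1 e (h1.trans hAT) h2
    have hv1 : ∀ j' : ι₁, Cm₁ e j' = 0 := fun j' => by
      rw [hCm₁, Matrix.of_apply]
      exact hc'T j'.1 e (h1.trans hAT) (fun h => absurd (hA1 j') (by omega))
    have hrow : (Cm₁ * N11.adjugate * N12) e j = 0 := by
      rw [Matrix.mul_assoc, Matrix.mul_apply]
      exact Finset.sum_eq_zero fun j' _ => by rw [hv1 j', zero_mul]
    rw [hc₂]
    simp only [Matrix.sub_apply, Matrix.smul_apply, smul_eq_mul, hrow, sub_zero, hv2, mul_zero]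
  · -- across classes
    intro i i' h
    have := hμ2 i
    have := hμ2 i'
    exact hlt i.1 i'.1 (by omega)
  · -- class sizes
    intro i
    rw [hcc i]
    exact hg i.1
  · -- windows
    intro i i' h
    have h3 := hμ2 i
    have h4 := hμ2 i'
    rw [hcc i]
    exact hwin i.1 i'.1 (by omega)
  · -- distinct residues
    intro i i' i'' h' h'' hres
    have h3 := hμ2 i
    have h4 := hμ2 i'
    have h5 := hμ2 i''
    exact Subtype.ext (hinj i.1 i'.1 i''.1 (by omega) (by omega) hres)


/-- **BLOCK VANDERMONDE, residue form (pure powers).** `char K = p`. Rows `ξ_i = X^{m_i}(1 + X ρ_i)`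
(`m_i ≥ 1`, `ρ` distinct inside valuation classes), distinct exponents `D` decreasing across increasing
valuation classes; for each row `i` data `s_i, A_i` with `#class(i) ≤ p^{s_i}` such that the shifted residues
`(D_j + p^{s_i} − A_i mod p^{s_i}) mod p^{s_i}` of the classmates `j` of `i` lie in `[0, #class(i))` and are
pairwise distinct (a window of cyclically consecutive residues; for `#class = p^{s}`: residues distinct).
Then `det [ξ_i^{D_j}] ≠ 0`. Consecutive exponents are the case `p^s > max D`. -/
theorem det_pow_ne_zero_of_residues (K : Type*) [Field K] (p : ℕ) [Fact p.Prime] [CharP K p]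
    {ι : Type u} [Fintype ι] [DecidableEq ι] (m : ι → ℕ) (ρ : ι → K[X]) (D : ι → ℕ) (s A : ι → ℕ)
    (hm : ∀ i, 1 ≤ m i) (hρ : ∀ i i', m i = m i' → ρ i = ρ i' → i = i') (hD : Function.Injective D)
    (hlt : ∀ i i', m i < m i' → D i' < D i)
    (hg : ∀ i, Fintype.card {k // m k = m i} ≤ p ^ s i)
    (hwin : ∀ i i', m i' = m i →
      (D i' + (p ^ s i - A i % p ^ s i)) % p ^ s i < Fintype.card {k // m k = m i})
    (hinj : ∀ i i' i'', m i' = m i → m i'' = m i →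
      (D i' + (p ^ s i - A i % p ^ s i)) % p ^ s i = (D i'' + (p ^ s i - A i % p ^ s i)) % p ^ s i →
        i' = i'') :
    (Matrix.of fun i j : ι => (X ^ (m i) * (1 + X * ρ i)) ^ (D j)).det ≠ 0 := by
  obtain ⟨N, hN⟩ : ∃ N, ∀ j, D j < N :=
    ⟨Finset.univ.sup D + 1, fun j => Nat.lt_succ_of_le (Finset.le_sup (Finset.mem_univ j))⟩
  have key := det_ne_zero_res_aux K p (Fintype.card ι) rfl m ρ D N N
    (fun j e => if (e : ℕ) = D j then (1 : K[X]) else 0) hN s A hm hρ hD hN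
    (fun j => by simp) (fun j e _ h2 => by simp [h2]) hlt hg hwin hinj
  have hmat : (Matrix.of fun i j : ι => (X ^ (m i) * (1 + X * ρ i)) ^ (D j)) =
      Matrix.of fun i j : ι => ∑ e : Fin N, (X ^ (m i) * (1 + X * ρ i)) ^ (e : ℕ) *
        (if (e : ℕ) = D j then (1 : K[X]) else 0) := by
    refine Matrix.ext fun i j => ?_
    rw [Matrix.of_apply, Matrix.of_apply, Finset.sum_eq_single (⟨D j, hN j⟩ : Fin N)]
    · simp
    · intro e _ he
      rw [if_neg fun h => he (Fin.ext h), mul_zero]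
    · intro h
      exact absurd (Finset.mem_univ _) h
  rw [hmat]
  exact key

end

end Summit.ValiantsHypothesis.ValiantsHypothesis.Theorems.BarrierLever.BlockVandermonde
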